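import Literature.Analysis.FluidPDE.PeriodicCylinderNeumannCovariance
import Literature.Analysis.FunctionSpaces.SmoothCutoff
import Mathlib.Analysis.InnerProductSpace.Laplacian
import HarnessLib

/-!
# The weak gradient of the potential against periodic test functions; the weak Laplacian of the
# cut-off potential

Topic `Literature/Analysis/FluidPDE`. Theorem-only file (no definitions, no named facts) of the
regularity theory for the weak periodic Neumann problem on the cylinder `{r ≤ 1} × ℝ/Lℤ`
(`PeriodicCylinderHelmholtz`, `PeriodicCylinderSymmetry`, `PeriodicCylinderNeumannCovariance`),
the analytic input of the local existence theorem for the Euler equations in the periodic cylinder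
(T. Kato, C. Y. Lai, J. Funct. Anal. **56** (1984); named fact
`Literature.Analysis.FluidPDE.KatoLai1984_periodicCylinderUniformExistence`). It prepares the
**interior regularity** step (Weyl's lemma on the flat torus, `TorusWeaklyHarmonic`), which needs
identities against test functions that are *periodic in `z`* — across the seams `z ∈ Lℤ` of the
period cell on which the weak objects live:

* `exists_seam_cutoff`, `exists_period_cutoff` — a smooth `L e_z`-periodic cut-off `χ` of the seams
  (`= 1` for `dist(z, Lℤ) ≤ L/8`, `= 0` for `dist(z, Lℤ) ≥ 3L/8`) and a smooth cut-off `ζ` of one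
  period (`= 1` on `L/8 ≤ z ≤ 7L/8`, `= 0` off `0 < z < L`), from the tree's mollified-indicator
  cut-offs (`exists_smooth_cutoff_periodic`, `exists_smooth_cutoff`, `SmoothCutoff.lean`);
* `setIntegral_fderiv_mul_potential_of_vanish_seam` — for `G ∈ 𝓖` with potential `q` and a smooth
  periodic `μ` vanishing near the wall and near the seams: `∫_cell ∂_vμ q = −∫_cell μ ⟪G, v⟫` (`μζ` is
  a test function on the open cell equal to `μ` there; weak gradient of the potential,
  `integral_fderiv_mul_fst_eq_of_mem_potentialGraphClosure`);
* `setIntegral_fderiv_mul_potential_of_periodic` — **the same for every smooth `L`-periodic `ψ`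
  vanishing near the wall**, with no condition at the seams: split `ψ = ψ(1 − χ) + ψχ`; the seam
  piece is moved by half a period with the measure-preserving periodic shift
  (`integral_comp_cellShift`) and identified through the covariance of the potential
  (`potential_axialShiftLp`, `coeFn_axialShiftLp`), where it vanishes near the seams;
* `setIntegral_cutoff_potential_mul_laplacian` — **the weak Laplacian of `w = θq`** for the weak
  Neumann solution `∇q[h₀,h₁]` with smooth periodic data (`∫ h₀ = 0`) and a smooth periodic cut-off
  `θ` vanishing near the wall: for every smooth `L`-periodic `Φ`,
  `∫_cell θ q ΔΦ = ∫_cell (θ(div h₁ − h₀) + 2 Dθ(∇q) + q Δθ) Φ` — from the previous theorem, the weak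
  Neumann equation tested with the periodic function `θΦ` (`setIntegral_inner_neumannGrad_cylGrad`)
  and the periodic Gauss–Green identity for the tangential field `θh₁`
  (`setIntegral_mul_divergence_add_fderiv_eq_zero`); `Δ` is Mathlib's Laplacian
  (`laplacian_eq_sum_fderiv_fderiv`);
* helpers: `contDiffOn_cylDiv`, `cylDiv_eq_divergence` (the divergence written within the closed
  cylinder), `IsAxiallyPeriodic.fderiv'`, integrability of continuous × `L²(cell)` products.

Mathlib/tree search: tree — everything cylinder-side listed above plus `divergence_smul_apply`,
`differentiableAt_of_contDiffOn_closure`, `inner_gradient_eq_fderiv`, `frontier_unitCylinder`;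
Mathlib — `InnerProductSpace.laplacian_eq_iteratedFDeriv_orthonormalBasis`, `iteratedFDeriv_two_apply`,
`fderiv_clm_apply`, `fderiv_comp_add_right`, `Integrable.bdd_mul`. Nothing on periodic test
functions for the cell's weak objects existed (`lean search 'seam|periodic.*test.*potential'`).

## References

* T. Kato, C. Y. Lai, J. Funct. Anal. 56 (1984) 15–28, §4 (i), §5. [KatoLai1984]
* L. C. Evans, *Partial Differential Equations*, 2nd ed. (2010), §5.2.1, §6.3.1. [Evans2010]
-/

noncomputable section

open MeasureTheory Set Function Filter Topology TopologicalSpace WithLp Metric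
open scoped ContDiff NNReal ENNReal InnerProductSpace RealInnerProductSpace Laplacian

namespace Literature.Analysis.FluidPDE

open Literature.Analysis.FunctionSpaces

/-- Local notation for physical space `ℝ³ = EuclideanSpace ℝ (Fin 3)`. -/
local notation "ℝ³" => EuclideanSpace ℝ (Fin 3)

/-- Local notation for the closed unit cylinder `{r ≤ 1}`. -/
local notation "𝕂" => closure (SetLike.coe unitCylinder : Set (EuclideanSpace ℝ (Fin 3)))

namespace PeriodicCylinder

variable {L : ℝ}

/-! ### Smooth periodic partition in `z` and a slab cut-off -/

/-- **A smooth `L`-periodic cut-off of the seams**: `χ` smooth, `L e_z`-periodic, equal to `1` where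
`dist(z, Lℤ) ≤ L/8` and to `0` where `dist(z, Lℤ) ≥ 3L/8` (from `exists_smooth_cutoff_periodic`
applied to the union of the slabs `|z − nL| < L/4`). [folklore] -/
theorem exists_seam_cutoff (hL : 0 < L) : ∃ χ : ℝ³ → ℝ, ContDiff ℝ ∞ χ ∧ IsAxiallyPeriodic L χ ∧
    (∀ x : ℝ³, (∃ n : ℤ, |x 2 - n * L| ≤ L / 8) → χ x = 1) ∧
    (∀ x : ℝ³, (∀ n : ℤ, 3 * L / 8 ≤ |x 2 - n * L|) → χ x = 0) := by
  obtain ⟨C, -, hC⟩ := exists_smooth_cutoff_periodic (G := ℝ³) (volume : Measure ℝ³)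
  set A : Set ℝ³ := {x | ∃ n : ℤ, |x 2 - n * L| < L / 4} with hA
  have hc2 : Continuous fun x : ℝ³ => x 2 := (continuous_apply 2).comp (PiLp.continuous_ofLp 2 _)
  have hAm : MeasurableSet A := by
    have : A = ⋃ n : ℤ, {x : ℝ³ | |x 2 - n * L| < L / 4} := by ext x; simp [hA]
    rw [this]
    exact (isOpen_iUnion fun n => isOpen_lt ((hc2.sub continuous_const).abs) continuous_const).measurableSet
  obtain ⟨χ, hχs, -, hχ1, hχ0, -, hχper⟩ := hC A hAm (L / 16) (by positivity)
  have hcoord : ∀ (x y : ℝ³), |y 2 - x 2| ≤ dist y x := fun x y => by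
    rw [dist_eq_norm, ← Real.norm_eq_abs]
    have h := PiLp.norm_apply_le (y - x) 2
    simpa using h
  refine ⟨χ, hχs, fun x => ?_, fun x ⟨n, hn⟩ => hχ1 x fun y hy => ?_, fun x hx => hχ0 x ?_⟩
  · -- periodicity: `A + L e_z = A`
    refine hχper (L • eZ) (fun y => ?_) x
    simp only [hA, mem_setOf_eq, PiLp.add_apply, smul_eZ_apply_two]
    constructor
    · rintro ⟨n, hn⟩; exact ⟨n - 1, by push_cast; rw [show y 2 - (n - 1) * L = y 2 + L - n * L by ring]; exact hn⟩
    · rintro ⟨n, hn⟩; exact ⟨n + 1, by push_cast; rw [show y 2 + L - (n + 1) * L = y 2 - n * L by ring]; exact hn⟩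
  · -- `ball x (L/16) ⊆ A` when `|x₂ − nL| ≤ L/8`
    refine ⟨n, ?_⟩
    have h1 := hcoord x y
    rw [mem_ball] at hy
    calc |y 2 - n * L| = |(y 2 - x 2) + (x 2 - n * L)| := by ring_nf
      _ ≤ |y 2 - x 2| + |x 2 - n * L| := abs_add_le _ _
      _ < L / 16 + L / 8 := by linarith
      _ < L / 4 := by linarith
  · -- `ball x (L/16)` misses `A` when `|x₂ − nL| ≥ 3L/8` for all `n`
    rw [Set.disjoint_left]
    rintro y hy ⟨n, hn⟩
    have h1 := hcoord x y
    rw [mem_ball] at hy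
    have h2 := hx n
    have : |x 2 - n * L| ≤ |x 2 - y 2| + |y 2 - n * L| := by
      calc |x 2 - n * L| = |(x 2 - y 2) + (y 2 - n * L)| := by ring_nf
        _ ≤ _ := abs_add_le _ _
    rw [abs_sub_comm (x 2) (y 2)] at this
    linarith

/-- **A smooth cut-off of one period**: `ζ` smooth with `ζ = 1` on `{L/16 ≤ z ≤ 15L/16}` and `ζ = 0` on
`{z ≤ −L/32} ∪ {z ≥ L + L/32}`… we only need: `ζ = 1` where `L/8 ≤ z ≤ 7L/8` and `ζ = 0` where `z ≤ 0`
or `z ≥ L`. [folklore] -/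
theorem exists_period_cutoff (hL : 0 < L) : ∃ ζ : ℝ³ → ℝ, ContDiff ℝ ∞ ζ ∧
    (∀ x : ℝ³, L / 8 ≤ x 2 → x 2 ≤ 7 * L / 8 → ζ x = 1) ∧ (∀ x : ℝ³, x 2 ≤ 0 ∨ L ≤ x 2 → ζ x = 0) := by
  obtain ⟨C, -, hC⟩ := exists_smooth_cutoff (G := ℝ³) (volume : Measure ℝ³)
  set A : Set ℝ³ := {x | L / 16 < x 2 ∧ x 2 < 15 * L / 16} with hA
  have hAm : MeasurableSet A := by
    have hc : Continuous fun x : ℝ³ => x 2 := (continuous_apply 2).comp (PiLp.continuous_ofLp 2 _)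
    exact (isOpen_lt continuous_const hc).measurableSet.inter (isOpen_lt hc continuous_const).measurableSet
  obtain ⟨ζ, hζs, -, hζ1, hζ0, -⟩ := hC A hAm (L / 16) (by positivity)
  have hcoord : ∀ (x y : ℝ³), |y 2 - x 2| ≤ dist y x := fun x y => by
    rw [dist_eq_norm, ← Real.norm_eq_abs]
    have h := PiLp.norm_apply_le (y - x) 2
    simpa using h
  refine ⟨ζ, hζs, fun x h1 h2 => hζ1 x fun y hy => ?_, fun x hx => hζ0 x ?_⟩
  · have h := hcoord x y
    rw [mem_ball] at hy
    have hy' := abs_lt.1 (lt_of_le_of_lt h hy)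
    exact ⟨by linarith [hy'.1], by linarith [hy'.2]⟩
  · rw [Set.disjoint_left]
    rintro y hy ⟨hy1, hy2⟩
    have h := hcoord x y
    rw [mem_ball] at hy
    have hy' := abs_lt.1 (lt_of_le_of_lt h hy)
    rcases hx with hx | hx <;> linarith [hy'.1, hy'.2]

/-! ### Test functions supported in one period -/

/-- A continuous function is bounded on the period cell (its closure is compact). [folklore] -/
theorem exists_bound_on_cell {φ : ℝ³ → ℝ} (hφ : Continuous φ) :
    ∃ C : ℝ, ∀ x ∈ (cylinderCell L : Set ℝ³), ‖φ x‖ ≤ C := by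
  obtain ⟨C, hC⟩ := (isBounded_cylinderCell L).isCompact_closure.exists_bound_of_continuousOn hφ.continuousOn
  exact ⟨C, fun x hx => hC x (subset_closure hx)⟩

/-- A continuous bounded factor times an `L²(cell)` class is integrable on the cell. [folklore] -/
theorem integrable_continuous_mul_coe {φ : ℝ³ → ℝ} (hφ : Continuous φ) (u : Lp ℝ 2 (cellMeasure L)) :
    Integrable (fun x => φ x * (u : ℝ³ → ℝ) x) (cellMeasure L) := by
  obtain ⟨C, hC⟩ := exists_bound_on_cell (L := L) hφ
  exact ((Lp.memLp u).integrable one_le_two).bdd_mul hφ.aestronglyMeasurable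
    (ae_restrict_of_forall_mem (cylinderCell L).isOpen.measurableSet hC)

/-- A continuous bounded factor times a component of an `L²(cell)` field is integrable on the cell.
[folklore] -/
theorem integrable_continuous_mul_inner_coe {φ : ℝ³ → ℝ} (hφ : Continuous φ)
    (u : Lp ℝ³ 2 (cellMeasure L)) (v : ℝ³) :
    Integrable (fun x => φ x * ⟪(u : ℝ³ → ℝ³) x, v⟫) (cellMeasure L) := by
  obtain ⟨C, hC⟩ := exists_bound_on_cell (L := L) hφ
  have h1 : Integrable (fun x => ⟪(u : ℝ³ → ℝ³) x, v⟫) (cellMeasure L) :=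
    ((Lp.memLp u).integrable one_le_two).inner_const v
  exact h1.bdd_mul hφ.aestronglyMeasurable (ae_restrict_of_forall_mem (cylinderCell L).isOpen.measurableSet hC)

/-- **The weak identity for smooth periodic functions vanishing near the seams and near the wall**:
if `μ` is smooth, `L`-periodic, vanishes for `r ≥ 1 − δ` and for `dist(z, Lℤ) ≤ L/8`, then
`∫_cell ∂_v μ · q = −∫_cell μ ⟪∇q, v⟫` for the potential `q` of any `G ∈ 𝓖` (cut `μ` down to one
period by a smooth cut-off `ζ`, which does not change it on the cell, and use the weak gradient of
the potential). [folklore] -/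
theorem setIntegral_fderiv_mul_potential_of_vanish_seam (hL : 0 < L) (G : gradSpace L) {μ : ℝ³ → ℝ}
    (hμ : ContDiff ℝ ∞ μ) {δ : ℝ} (hδ : 0 < δ) (hμ0 : ∀ x : ℝ³, 1 - δ ≤ cylRadius x → μ x = 0)
    (hμs : ∀ x : ℝ³, (∃ n : ℤ, |x 2 - n * L| ≤ L / 8) → μ x = 0) (v : ℝ³) :
    ∫ x in (cylinderCell L : Set ℝ³), fderiv ℝ μ x v * ((potential G : Lp ℝ 2 (cellMeasure L)) : ℝ³ → ℝ) x =
      -∫ x in (cylinderCell L : Set ℝ³), μ x * ⟪(((G : gradSpace L) : Lp ℝ³ 2 (cellMeasure L)) : ℝ³ → ℝ³) x, v⟫ := by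
  obtain ⟨ζ, hζs, hζ1, hζ0⟩ := exists_period_cutoff (L := L) hL
  set φ : ℝ³ → ℝ := fun x => μ x * ζ x with hφ
  -- the support of `φ`
  set K : Set ℝ³ := {x | cylRadius x ≤ 1 - δ} ∩ {x | L / 8 ≤ x 2 ∧ x 2 ≤ 7 * L / 8} with hK
  have hc2 : Continuous fun x : ℝ³ => x 2 := (continuous_apply 2).comp (PiLp.continuous_ofLp 2 _)
  have hKc : IsClosed K :=
    (isClosed_le (continuous_cylRadius) continuous_const).inter
      ((isClosed_le continuous_const hc2).inter (isClosed_le hc2 continuous_const))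
  have hsuppK : support φ ⊆ K := fun x hx => by
    rw [mem_support] at hx
    have hμx : μ x ≠ 0 := fun h => hx (by simp [hφ, h])
    have hζx : ζ x ≠ 0 := fun h => hx (by simp [hφ, h])
    refine ⟨?_, ?_, ?_⟩
    · by_contra h; exact hμx (hμ0 x (not_le.1 h).le)
    · by_contra h
      have hz0 : 0 < x 2 := by
        by_contra h'; exact hζx (hζ0 x (Or.inl (not_lt.1 h')))
      exact hμx (hμs x ⟨0, by push_cast; rw [zero_mul, sub_zero, abs_of_pos hz0]; linarith [not_le.1 h]⟩)
    · by_contra h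
      have hzL : x 2 < L := by
        by_contra h'; exact hζx (hζ0 x (Or.inr (not_lt.1 h')))
      exact hμx (hμs x ⟨1, by push_cast; rw [one_mul, abs_sub_comm, abs_of_pos (by linarith)]; linarith [not_le.1 h]⟩)
  have hKcell : K ⊆ (cylinderCell L : Set ℝ³) := fun x hx =>
    ⟨lt_of_le_of_lt hx.1 (by linarith), by linarith [hx.2.1], by linarith [hx.2.2]⟩
  have hKbdd : Bornology.IsBounded K := (isBounded_cylinderCell L).subset hKcell
  have hKcpt : IsCompact K := Metric.isCompact_of_isClosed_isBounded hKc hKbdd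
  have htest : IsTestFunctionOn (cylinderCell L) φ := by
    refine ⟨hμ.mul hζs, ?_, ?_⟩
    · exact HasCompactSupport.of_support_subset_isCompact hKcpt hsuppK
    · exact (closure_minimal hsuppK hKc).trans hKcell
  -- on the cell `φ = μ`
  have heq : ∀ x ∈ (cylinderCell L : Set ℝ³), φ x = μ x := fun x hx => by
    by_cases h1 : L / 8 ≤ x 2 ∧ x 2 ≤ 7 * L / 8
    · simp [hφ, hζ1 x h1.1 h1.2]
    · have : μ x = 0 := by
        rcases not_and_or.1 h1 with h | h
        · exact hμs x ⟨0, by push_cast; rw [zero_mul, sub_zero, abs_of_pos hx.2.1]; linarith [not_le.1 h]⟩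
        · exact hμs x ⟨1, by push_cast; rw [one_mul, abs_sub_comm, abs_of_pos (by linarith [hx.2.2])]; linarith [not_le.1 h]⟩
      simp [hφ, this]
  have hfd : ∀ x ∈ (cylinderCell L : Set ℝ³), fderiv ℝ φ x = fderiv ℝ μ x := fun x hx => by
    refine Filter.EventuallyEq.fderiv_eq ?_
    filter_upwards [(cylinderCell L).isOpen.mem_nhds hx] with y hy
    exact heq y hy
  have key := integral_fderiv_mul_fst_eq_of_mem_potentialGraphClosure (potential_mem hL G) htest v
  simp only at key
  rw [setIntegral_congr_fun (cylinderCell L).isOpen.measurableSet (fun x hx => by rw [hfd x hx])] at key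
  rw [key]
  congr 1
  exact setIntegral_congr_fun (cylinderCell L).isOpen.measurableSet fun x hx => by rw [heq x hx]

/-- The derivative of an `L`-periodic differentiable function is `L`-periodic. [folklore] -/
theorem _root_.Literature.Analysis.FluidPDE.IsAxiallyPeriodic.fderiv' {f : ℝ³ → ℝ} (hf : IsAxiallyPeriodic L f) :
    IsAxiallyPeriodic L (fderiv ℝ f) := fun x => by
  have h : (fun y => f (y + L • eZ)) = f := funext fun y => hf y
  have h2 := congrArg (fun g => fderiv ℝ g x) h
  simp only [fderiv_comp_add_right] at h2
  exact h2

/-- **The weak gradient of the potential against periodic test functions** (the identity across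
the seams `z ∈ Lℤ`): for `G ∈ 𝓖` with potential `q`, every smooth `L`-periodic `ψ` vanishing for
`r ≥ 1 − δ`, and every direction `v`, `∫_cell ∂_v ψ · q = −∫_cell ψ ⟪∇q… = G, v⟫`. Proof: split
`ψ = ψ(1 − χ) + ψχ` with the seam cut-off `χ`; the first piece vanishes near the seams; the second
is moved by half a period with the measure-preserving periodic shift (`integral_comp_cellShift`),
where it vanishes near the seams, and the covariance of the potential (`potential_axialShiftLp`)
identifies the shifted pair. [folklore] -/
theorem setIntegral_fderiv_mul_potential_of_periodic (hL : 0 < L) (G : gradSpace L) {ψ : ℝ³ → ℝ}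
    (hψ : ContDiff ℝ ∞ ψ) (hψp : IsAxiallyPeriodic L ψ) {δ : ℝ} (hδ : 0 < δ)
    (hψ0 : ∀ x : ℝ³, 1 - δ ≤ cylRadius x → ψ x = 0) (v : ℝ³) :
    ∫ x in (cylinderCell L : Set ℝ³), fderiv ℝ ψ x v * ((potential G : Lp ℝ 2 (cellMeasure L)) : ℝ³ → ℝ) x =
      -∫ x in (cylinderCell L : Set ℝ³), ψ x * ⟪(((G : gradSpace L) : Lp ℝ³ 2 (cellMeasure L)) : ℝ³ → ℝ³) x, v⟫ := by
  obtain ⟨χ, hχs, hχp, hχ1, hχ0⟩ := exists_seam_cutoff (L := L) hL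
  -- the two pieces
  set μ₁ : ℝ³ → ℝ := fun x => ψ x * (1 - χ x) with hμ₁
  set ν : ℝ³ → ℝ := fun x => ψ x * χ x with hν
  set a : ℝ := L / 2 with ha
  set μ₂ : ℝ³ → ℝ := fun x => ν (x + a • eZ) with hμ₂
  have hνs : ContDiff ℝ ∞ ν := hψ.mul hχs
  have hνp : IsAxiallyPeriodic L ν := fun x => by simp only [hν, hψp x, hχp x]
  have hμ₁s : ContDiff ℝ ∞ μ₁ := hψ.mul (contDiff_const.sub hχs)
  have hμ₂s : ContDiff ℝ ∞ μ₂ := hνs.comp (contDiff_id.add contDiff_const)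
  -- piece 1
  have E1 := setIntegral_fderiv_mul_potential_of_vanish_seam hL G hμ₁s hδ
    (fun x hx => by simp [hμ₁, hψ0 x hx]) (fun x hx => by simp [hμ₁, hχ1 x hx]) v
  -- piece 2, for the shifted pair
  set UG : gradSpace L := ⟨axialShiftLp L a (G : Lp ℝ³ 2 (cellMeasure L)), axialShiftLp_mem_gradSpace hL a G.2⟩ with hUG
  have hμ₂0 : ∀ x : ℝ³, 1 - δ ≤ cylRadius x → μ₂ x = 0 := fun x hx => by
    simp only [hμ₂, hν]
    rw [hψ0 _ (by rwa [cylRadius_add_smul_eZ]), zero_mul]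
  have hμ₂s0 : ∀ x : ℝ³, (∃ n : ℤ, |x 2 - n * L| ≤ L / 8) → μ₂ x = 0 := fun x ⟨n, hn⟩ => by
    simp only [hμ₂, hν]
    rw [hχ0 _ fun m => ?_, mul_zero]
    simp only [PiLp.add_apply, smul_eZ_apply_two, ha]
    have h1 : |(L / 2 - (m - n) * L)| ≥ L / 2 := by
      rw [show L / 2 - (m - n) * L = (1 / 2 - ((m - n : ℤ) : ℝ)) * L by push_cast; ring, abs_mul, abs_of_pos hL]
      have : (1 / 2 : ℝ) ≤ |1 / 2 - ((m - n : ℤ) : ℝ)| := by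
        rcases le_or_gt ((m - n : ℤ) : ℝ) 0 with h | h
        · rw [abs_of_pos (by linarith)]; linarith
        · have h' : (1 : ℝ) ≤ ((m - n : ℤ) : ℝ) := by exact_mod_cast h
          rw [abs_of_nonpos (by linarith)]; linarith
      nlinarith
    calc 3 * L / 8 ≤ L / 2 - L / 8 := by linarith
      _ ≤ |L / 2 - (m - n) * L| - |x 2 - n * L| := by linarith [h1.le]
      _ ≤ |x 2 + L / 2 - m * L| := by
          have := abs_sub_abs_le_abs_sub (L / 2 - (m - n) * L) (-(x 2 - n * L))
          rw [abs_neg] at this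
          calc |L / 2 - (m - n) * L| - |x 2 - n * L| ≤ |L / 2 - (m - n) * L - -(x 2 - n * L)| := this
            _ = |x 2 + L / 2 - m * L| := by ring_nf
  have E2 := setIntegral_fderiv_mul_potential_of_vanish_seam hL UG hμ₂s hδ hμ₂0 hμ₂s0 v
  -- identify the shifted pair: `pot(UG) = q ∘ shift`, `UG = G ∘ shift` a.e.
  have hpot : ((potential UG : Lp ℝ 2 (cellMeasure L)) : ℝ³ → ℝ) =ᵐ[cellMeasure L]
      fun x => ((potential G : Lp ℝ 2 (cellMeasure L)) : ℝ³ → ℝ) (cellShift L a x) := by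
    rw [hUG, potential_axialShiftLp hL a G]
    exact coeFn_axialShiftLp hL a _
  have hUGae : (((UG : gradSpace L) : Lp ℝ³ 2 (cellMeasure L)) : ℝ³ → ℝ³) =ᵐ[cellMeasure L]
      fun x => (((G : gradSpace L) : Lp ℝ³ 2 (cellMeasure L)) : ℝ³ → ℝ³) (cellShift L a x) :=
    coeFn_axialShiftLp hL a _
  -- `μ₂ = ν ∘ shift`, `∂μ₂ = ∂ν ∘ shift`
  have hμ₂eq : ∀ x, μ₂ x = ν (cellShift L a x) := fun x => (hνp.comp_cellShift a x).symm
  have hdμ₂ : ∀ x, fderiv ℝ μ₂ x v = fderiv ℝ ν (cellShift L a x) v := fun x => by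
    simp only [hμ₂]
    rw [fderiv_comp_add_right, ← hνp.fderiv'.comp_cellShift a x]
  -- rewrite E2 as integrals of shifted functions, then unshift
  have E2l : ∫ x in (cylinderCell L : Set ℝ³), fderiv ℝ μ₂ x v * ((potential UG : Lp ℝ 2 (cellMeasure L)) : ℝ³ → ℝ) x =
      ∫ x in (cylinderCell L : Set ℝ³), fderiv ℝ ν x v * ((potential G : Lp ℝ 2 (cellMeasure L)) : ℝ³ → ℝ) x := by
    have hm : AEStronglyMeasurable (fun x => fderiv ℝ ν x v * ((potential G : Lp ℝ 2 (cellMeasure L)) : ℝ³ → ℝ) x)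
        (cellMeasure L) :=
      ((hνs.continuous_fderiv (by simp)).clm_apply continuous_const).aestronglyMeasurable.mul (Lp.aestronglyMeasurable _)
    rw [← integral_comp_cellShift hL a hm]
    refine integral_congr_ae ?_
    filter_upwards [hpot] with x hx
    rw [hx, hdμ₂]
  have E2r : ∫ x in (cylinderCell L : Set ℝ³), μ₂ x * ⟪(((UG : gradSpace L) : Lp ℝ³ 2 (cellMeasure L)) : ℝ³ → ℝ³) x, v⟫ =
      ∫ x in (cylinderCell L : Set ℝ³), ν x * ⟪(((G : gradSpace L) : Lp ℝ³ 2 (cellMeasure L)) : ℝ³ → ℝ³) x, v⟫ := by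
    have hm : AEStronglyMeasurable (fun x => ν x * ⟪(((G : gradSpace L) : Lp ℝ³ 2 (cellMeasure L)) : ℝ³ → ℝ³) x, v⟫)
        (cellMeasure L) :=
      hνs.continuous.aestronglyMeasurable.mul ((Lp.aestronglyMeasurable _).inner aestronglyMeasurable_const)
    rw [← integral_comp_cellShift hL a hm]
    refine integral_congr_ae ?_
    filter_upwards [hUGae] with x hx
    rw [hx, hμ₂eq]
  rw [E2l, E2r] at E2
  -- add the pieces
  have hψd : Differentiable ℝ ψ := hψ.differentiable (by simp)
  have hχd : Differentiable ℝ χ := hχs.differentiable (by simp)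
  have hsplit : ∀ x, fderiv ℝ ψ x v = fderiv ℝ μ₁ x v + fderiv ℝ ν x v := fun x => by
    have hsum : μ₁ + ν = ψ := funext fun x => by simp only [Pi.add_apply, hμ₁, hν]; ring
    have h := fderiv_add (hμ₁s.differentiable (by simp) x) (hνs.differentiable (by simp) x)
    rw [hsum] at h
    rw [h, _root_.add_apply]
  have hsum' : ∀ x, ψ x = μ₁ x + ν x := fun x => by simp only [hμ₁, hν]; ring
  have I1 := integrable_continuous_mul_coe ((hμ₁s.continuous_fderiv (by simp)).clm_apply (continuous_const (y := v)))
    (potential G : Lp ℝ 2 (cellMeasure L))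
  have I2 := integrable_continuous_mul_coe ((hνs.continuous_fderiv (by simp)).clm_apply (continuous_const (y := v)))
    (potential G : Lp ℝ 2 (cellMeasure L))
  have J1 := integrable_continuous_mul_inner_coe hμ₁s.continuous ((G : gradSpace L) : Lp ℝ³ 2 (cellMeasure L)) v
  have J2 := integrable_continuous_mul_inner_coe hνs.continuous ((G : gradSpace L) : Lp ℝ³ 2 (cellMeasure L)) v
  calc ∫ x in (cylinderCell L : Set ℝ³), fderiv ℝ ψ x v * ((potential G : Lp ℝ 2 (cellMeasure L)) : ℝ³ → ℝ) x
      = ∫ x in (cylinderCell L : Set ℝ³), (fderiv ℝ μ₁ x v * ((potential G : Lp ℝ 2 (cellMeasure L)) : ℝ³ → ℝ) x +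
          fderiv ℝ ν x v * ((potential G : Lp ℝ 2 (cellMeasure L)) : ℝ³ → ℝ) x) :=
        integral_congr_ae (Eventually.of_forall fun x => by simp only [hsplit x, add_mul])
    _ = -(∫ x in (cylinderCell L : Set ℝ³), μ₁ x * ⟪(((G : gradSpace L) : Lp ℝ³ 2 (cellMeasure L)) : ℝ³ → ℝ³) x, v⟫) +
        -(∫ x in (cylinderCell L : Set ℝ³), ν x * ⟪(((G : gradSpace L) : Lp ℝ³ 2 (cellMeasure L)) : ℝ³ → ℝ³) x, v⟫) := by
        rw [integral_add I1 I2, E1, E2]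
    _ = -∫ x in (cylinderCell L : Set ℝ³), ψ x * ⟪(((G : gradSpace L) : Lp ℝ³ 2 (cellMeasure L)) : ℝ³ → ℝ³) x, v⟫ := by
        rw [← neg_add, ← integral_add J1 J2]
        congr 1
        exact integral_congr_ae (Eventually.of_forall fun x => by simp only [hsum' x, add_mul])

/-! ### The divergence within the closed cylinder -/

/-- The divergence *within* the closed cylinder, `Σᵢ (∂ᵢ h₁)ᵢ` with derivatives within `𝕂`, is
smooth on `𝕂`. [folklore] -/
theorem contDiffOn_cylDiv {h₁ : ℝ³ → ℝ³} (hh : ContDiffOn ℝ ∞ h₁ 𝕂) :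
    ContDiffOn ℝ ∞ (fun x => ∑ i : Fin 3, (cylDeriv (fun _ => cylBasis i) h₁ x) i) 𝕂 :=
  ContDiffOn.sum fun i _ => (EuclideanSpace.proj i : ℝ³ →L[ℝ] ℝ).contDiff.comp_contDiffOn
    (contDiffOn_cylDeriv contDiff_const hh)

/-- On the open cylinder the divergence within equals the divergence. [folklore] -/
theorem cylDiv_eq_divergence (h₁ : ℝ³ → ℝ³) {x : ℝ³} (hx : x ∈ (unitCylinder : Set ℝ³)) :
    ∑ i : Fin 3, (cylDeriv (fun _ => cylBasis i) h₁ x) i = VectorCalculus.divergence h₁ x := by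
  rw [divergence_eq_sum_fderiv_single]
  exact Finset.sum_congr rfl fun i _ => by rw [cylDeriv_eq_fderiv _ _ hx]; rfl

/-! ### The weak Laplacian of the cut-off potential against periodic test functions -/

/-- The Laplacian as the sum of pure second derivatives along the standard basis (for `C²`
functions). [folklore] -/
theorem laplacian_eq_sum_fderiv_fderiv {Φ : ℝ³ → ℝ} (hΦ : ContDiff ℝ 2 Φ) (x : ℝ³) :
    (Δ Φ) x = ∑ i : Fin 3, fderiv ℝ (fun y => fderiv ℝ Φ y (EuclideanSpace.basisFun (Fin 3) ℝ i)) x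
      (EuclideanSpace.basisFun (Fin 3) ℝ i) := by
  rw [InnerProductSpace.laplacian_eq_iteratedFDeriv_orthonormalBasis Φ (EuclideanSpace.basisFun (Fin 3) ℝ)]
  refine Finset.sum_congr rfl fun i _ => ?_
  rw [iteratedFDeriv_two_apply]
  have hd : DifferentiableAt ℝ (fderiv ℝ Φ) x :=
    ((hΦ.fderiv_right (m := 1) (by norm_num)).differentiable one_ne_zero) x
  rw [fderiv_clm_apply hd (differentiableAt_const _), fderiv_const_apply]
  simp

/-- A component function `x ↦ Dφ(x) v` of a smooth `L`-periodic function is smooth `L`-periodic.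
[folklore] -/
theorem contDiff_fderiv_apply_const {φ : ℝ³ → ℝ} (hφ : ContDiff ℝ ∞ φ) (v : ℝ³) :
    ContDiff ℝ ∞ fun x => fderiv ℝ φ x v :=
  (hφ.fderiv_right (m := ∞) (by simp)).clm_apply contDiff_const

/-- **The weak Laplacian of `w = θq`**: let `∇q = ∇q[h₀,h₁]` be the weak Neumann solution for smooth
periodic data with `∫_cell h₀ = 0`, `q` its potential, and `θ` a smooth `L`-periodic cut-off
vanishing for `r ≥ 1 − δ`. Then for every smooth `L`-periodic `Φ`,
`∫_cell θ q ΔΦ = ∫_cell F Φ` with `F = θ(div h₁ − h₀) + 2 Dθ(∇q) + q Δθ` — the distributional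
identity `Δ(θq) = θΔq + 2⟪∇θ,∇q⟫ + qΔθ` with `Δq = div h₁ − h₀`, obtained from the weak gradient of
`q` across the seams (`setIntegral_fderiv_mul_potential_of_periodic`), the weak Neumann equation
(`setIntegral_inner_neumannGrad_cylGrad`) and the periodic Gauss–Green identity
(`setIntegral_mul_divergence_add_fderiv_eq_zero`, applied to the field `θh₁`, tangential because it
vanishes near the wall). [folklore] -/
theorem setIntegral_cutoff_potential_mul_laplacian (hL : 0 < L) {h₀ : ℝ³ → ℝ} {h₁ : ℝ³ → ℝ³}
    (hh₀ : IsSmoothPeriodic L h₀) (hh₁ : IsSmoothPeriodic L h₁)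
    (hmean : ∫ x in (cylinderCell L : Set ℝ³), h₀ x = 0) {θ : ℝ³ → ℝ} (hθ : ContDiff ℝ ∞ θ)
    (hθp : IsAxiallyPeriodic L θ) {δ : ℝ} (hδ : 0 < δ) (hθ0 : ∀ x : ℝ³, 1 - δ ≤ cylRadius x → θ x = 0)
    {Φ : ℝ³ → ℝ} (hΦ : ContDiff ℝ ∞ Φ) (hΦp : IsAxiallyPeriodic L Φ) :
    ∫ x in (cylinderCell L : Set ℝ³), θ x *
        ((potential (neumannGrad L (toCell L h₀) (toCell L h₁)) : Lp ℝ 2 (cellMeasure L)) : ℝ³ → ℝ) x * (Δ Φ) x =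
      ∫ x in (cylinderCell L : Set ℝ³),
        (θ x * (VectorCalculus.divergence h₁ x - h₀ x) +
          2 * fderiv ℝ θ x ((((neumannGrad L (toCell L h₀) (toCell L h₁) : gradSpace L) :
            Lp ℝ³ 2 (cellMeasure L)) : ℝ³ → ℝ³) x) +
          ((potential (neumannGrad L (toCell L h₀) (toCell L h₁)) : Lp ℝ 2 (cellMeasure L)) : ℝ³ → ℝ) x * (Δ θ) x) *
        Φ x := by
  -- names
  set Gg : gradSpace L := neumannGrad L (toCell L h₀) (toCell L h₁) with hGg
  set G : ℝ³ → ℝ³ := (((Gg : gradSpace L) : Lp ℝ³ 2 (cellMeasure L)) : ℝ³ → ℝ³) with hGdef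
  set q : ℝ³ → ℝ := ((potential Gg : Lp ℝ 2 (cellMeasure L)) : ℝ³ → ℝ) with hqdef
  set b := EuclideanSpace.basisFun (Fin 3) ℝ with hb
  have hbp : ∀ i, (b i : ℝ³) = EuclideanSpace.single i 1 := fun i => by simp [hb]
  -- components
  set g : Fin 3 → ℝ³ → ℝ := fun i y => fderiv ℝ Φ y (b i) with hg
  set t : Fin 3 → ℝ³ → ℝ := fun i y => fderiv ℝ θ y (b i) with ht
  have hgs : ∀ i, ContDiff ℝ ∞ (g i) := fun i => contDiff_fderiv_apply_const hΦ _
  have hts : ∀ i, ContDiff ℝ ∞ (t i) := fun i => contDiff_fderiv_apply_const hθ _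
  have hgp : ∀ i, IsAxiallyPeriodic L (g i) := fun i x => by simp only [hg, hΦp.fderiv' x]
  have htp : ∀ i, IsAxiallyPeriodic L (t i) := fun i x => by simp only [ht, hθp.fderiv' x]
  have hΦ2 : ContDiff ℝ 2 Φ := hΦ.of_le (by norm_cast)
  have hθ2 : ContDiff ℝ 2 θ := hθ.of_le (by norm_cast)
  have hΦd : Differentiable ℝ Φ := hΦ.differentiable (by simp)
  have hθd : Differentiable ℝ θ := hθ.differentiable (by simp)
  have hgd : ∀ i, Differentiable ℝ (g i) := fun i => (hgs i).differentiable (by simp)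
  have htd : ∀ i, Differentiable ℝ (t i) := fun i => (hts i).differentiable (by simp)
  -- basis expansions of `Dφ(G x)`
  have hexpand : ∀ (φ : ℝ³ → ℝ) (x : ℝ³), fderiv ℝ φ x (G x) = ∑ i, fderiv ℝ φ x (b i) * ⟪G x, b i⟫ := fun φ x => by
    conv_lhs => rw [← b.sum_repr' (G x)]
    rw [map_sum]
    refine Finset.sum_congr rfl fun i _ => ?_
    rw [map_smul, smul_eq_mul, mul_comm, real_inner_comm]
  -- (S1ᵢ): `∫ ∂ᵢ(θ gᵢ) q = −∫ θ gᵢ Gᵢ`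
  have S1 : ∀ i, ∫ x in (cylinderCell L : Set ℝ³), (t i x * g i x + θ x * fderiv ℝ (g i) x (b i)) * q x =
      -∫ x in (cylinderCell L : Set ℝ³), (θ x * g i x) * ⟪G x, b i⟫ := fun i => by
    have h := setIntegral_fderiv_mul_potential_of_periodic hL Gg (hθ.mul (hgs i)) (fun x => by
      simp only [hθp x, hgp i x]) hδ (fun x hx => by simp [hθ0 x hx]) (b i)
    rw [← h]
    refine setIntegral_congr_fun (cylinderCell L).isOpen.measurableSet fun x _ => ?_
    rw [fderiv_fun_mul (hθd x) (hgd i x)]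
    simp only [_root_.add_apply, _root_.FunLike.coe_smul, Pi.smul_apply, smul_eq_mul, ht]
    ring
  -- `tᵢ = ∂ᵢθ` vanishes for `r ≥ 1 − δ/2`
  have ht0 : ∀ i (x : ℝ³), 1 - δ / 2 ≤ cylRadius x → t i x = 0 := fun i x hx => by
    have hev : θ =ᶠ[𝓝 x] fun _ => 0 := by
      filter_upwards [(isOpen_lt continuous_const continuous_cylRadius).mem_nhds
        (show 1 - δ < cylRadius x by linarith)] with y hy
      exact hθ0 y hy.le
    simp only [ht, hev.fderiv_eq, fderiv_const_apply, _root_.zero_apply]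
  -- (S2ᵢ): `∫ ∂ᵢ(Φ tᵢ) q = −∫ Φ tᵢ Gᵢ`
  have S2 : ∀ i, ∫ x in (cylinderCell L : Set ℝ³), (g i x * t i x + Φ x * fderiv ℝ (t i) x (b i)) * q x =
      -∫ x in (cylinderCell L : Set ℝ³), (Φ x * t i x) * ⟪G x, b i⟫ := fun i => by
    have h := setIntegral_fderiv_mul_potential_of_periodic hL Gg (hΦ.mul (hts i)) (fun x => by
      simp only [hΦp x, htp i x]) (half_pos hδ) (fun x hx => by simp [ht0 i x hx]) (b i)
    rw [← h]
    refine setIntegral_congr_fun (cylinderCell L).isOpen.measurableSet fun x _ => ?_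
    rw [fderiv_fun_mul (hΦd x) (htd i x)]
    simp only [_root_.add_apply, _root_.FunLike.coe_smul, Pi.smul_apply, smul_eq_mul, hg]
    ring
  -- integrability helpers
  have Icq : ∀ {φ : ℝ³ → ℝ}, Continuous φ → Integrable (fun x => φ x * q x) (cellMeasure L) :=
    fun hφ => integrable_continuous_mul_coe hφ _
  have IcG : ∀ {φ : ℝ³ → ℝ}, Continuous φ → ∀ i, Integrable (fun x => φ x * ⟪G x, b i⟫) (cellMeasure L) :=
    fun hφ i => integrable_continuous_mul_inner_coe hφ _ (b i)
  have hgc : ∀ i, Continuous (g i) := fun i => (hgs i).continuous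
  have htc : ∀ i, Continuous (t i) := fun i => (hts i).continuous
  have hdgc : ∀ i, Continuous fun x => fderiv ℝ (g i) x (b i) := fun i => (contDiff_fderiv_apply_const (hgs i) _).continuous
  have hdtc : ∀ i, Continuous fun x => fderiv ℝ (t i) x (b i) := fun i => (contDiff_fderiv_apply_const (hts i) _).continuous
  have hLΦ : (Δ Φ) = fun x => ∑ i, fderiv ℝ (g i) x (b i) := funext (laplacian_eq_sum_fderiv_fderiv hΦ2)
  have hLθ : (Δ θ) = fun x => ∑ i, fderiv ℝ (t i) x (b i) := funext (laplacian_eq_sum_fderiv_fderiv hθ2)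
  simp only [hLΦ, hLθ]
  have hΔΦc : Continuous fun x => ∑ i, fderiv ℝ (g i) x (b i) := continuous_finsetSum _ fun i _ => hdgc i
  have hΔθc : Continuous fun x => ∑ i, fderiv ℝ (t i) x (b i) := continuous_finsetSum _ fun i _ => hdtc i
  -- named integrals
  obtain ⟨A, hA⟩ : ∃ A : ℝ, A = ∫ x in (cylinderCell L : Set ℝ³), θ x * q x * (∑ i, fderiv ℝ (g i) x (b i)) := ⟨_, rfl⟩
  obtain ⟨P, hP⟩ : ∃ P : ℝ, P = ∫ x in (cylinderCell L : Set ℝ³), (∑ i, t i x * g i x) * q x := ⟨_, rfl⟩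
  obtain ⟨B, hB⟩ : ∃ B : ℝ, B = ∫ x in (cylinderCell L : Set ℝ³), θ x * fderiv ℝ Φ x (G x) := ⟨_, rfl⟩
  obtain ⟨Q, hQ⟩ : ∃ Q : ℝ, Q = ∫ x in (cylinderCell L : Set ℝ³), Φ x * q x * (∑ i, fderiv ℝ (t i) x (b i)) := ⟨_, rfl⟩
  obtain ⟨R, hR⟩ : ∃ R : ℝ, R = ∫ x in (cylinderCell L : Set ℝ³), Φ x * fderiv ℝ θ x (G x) := ⟨_, rfl⟩
  obtain ⟨H0, hH0⟩ : ∃ H0 : ℝ, H0 = ∫ x in (cylinderCell L : Set ℝ³), h₀ x * (θ x * Φ x) := ⟨_, rfl⟩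
  obtain ⟨DV, hDV⟩ : ∃ DV : ℝ, DV = ∫ x in (cylinderCell L : Set ℝ³), Φ x * θ x * VectorCalculus.divergence h₁ x := ⟨_, rfl⟩
  obtain ⟨R1, hR1⟩ : ∃ R1 : ℝ, R1 = ∫ x in (cylinderCell L : Set ℝ³), Φ x * fderiv ℝ θ x (h₁ x) := ⟨_, rfl⟩
  obtain ⟨B1, hB1⟩ : ∃ B1 : ℝ, B1 = ∫ x in (cylinderCell L : Set ℝ³), θ x * fderiv ℝ Φ x (h₁ x) := ⟨_, rfl⟩
  -- sum of (S1): `P + A = −B`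
  have hS1 : P + A = -B := by
    have lhs : ∀ i, Integrable (fun x => (t i x * g i x + θ x * fderiv ℝ (g i) x (b i)) * q x) (cellMeasure L) :=
      fun i => Icq (φ := fun x => t i x * g i x + θ x * fderiv ℝ (g i) x (b i)) (((htc i).mul (hgc i)).add (hθ.continuous.mul (hdgc i)))
    have e1 : ∑ i, ∫ x in (cylinderCell L : Set ℝ³), (t i x * g i x + θ x * fderiv ℝ (g i) x (b i)) * q x = P + A := by
      rw [← integral_finsetSum _ fun i _ => lhs i, hP, hA,
        ← integral_add (Icq (φ := fun x => ∑ i, t i x * g i x) (continuous_finsetSum _ fun i _ => (htc i).mul (hgc i)))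
          ((Icq (φ := fun x => θ x * ∑ i, fderiv ℝ (g i) x (b i)) (hθ.continuous.mul hΔΦc)).congr
            (Eventually.of_forall fun x => by ring))]
      refine integral_congr_ae (Eventually.of_forall fun x => ?_)
      simp only [Finset.sum_mul, Finset.mul_sum, add_mul]
      rw [Finset.sum_add_distrib]
      exact congrArg₂ (· + ·) rfl (Finset.sum_congr rfl fun i _ => by ring)
    have e2 : ∑ i, -∫ x in (cylinderCell L : Set ℝ³), (θ x * g i x) * ⟪G x, b i⟫ = -B := by
      rw [Finset.sum_neg_distrib, ← integral_finsetSum _ fun i _ => IcG (φ := fun x => θ x * g i x) (hθ.continuous.mul (hgc i)) i, hB]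
      congr 1
      refine integral_congr_ae (Eventually.of_forall fun x => ?_)
      simp only [hexpand Φ x, Finset.mul_sum]
      exact Finset.sum_congr rfl fun i _ => by simp only [hg]; ring
    rw [← e1, ← e2]
    exact Finset.sum_congr rfl fun i _ => S1 i
  -- sum of (S2): `P + Q = −R`
  have hS2 : P + Q = -R := by
    have lhs : ∀ i, Integrable (fun x => (g i x * t i x + Φ x * fderiv ℝ (t i) x (b i)) * q x) (cellMeasure L) :=
      fun i => Icq (φ := fun x => g i x * t i x + Φ x * fderiv ℝ (t i) x (b i)) (((hgc i).mul (htc i)).add (hΦ.continuous.mul (hdtc i)))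
    have e1 : ∑ i, ∫ x in (cylinderCell L : Set ℝ³), (g i x * t i x + Φ x * fderiv ℝ (t i) x (b i)) * q x = P + Q := by
      rw [← integral_finsetSum _ fun i _ => lhs i, hP, hQ,
        ← integral_add (Icq (φ := fun x => ∑ i, t i x * g i x) (continuous_finsetSum _ fun i _ => (htc i).mul (hgc i)))
          ((Icq (φ := fun x => Φ x * ∑ i, fderiv ℝ (t i) x (b i)) (hΦ.continuous.mul hΔθc)).congr
            (Eventually.of_forall fun x => by ring))]
      refine integral_congr_ae (Eventually.of_forall fun x => ?_)
      simp only [Finset.sum_mul, Finset.mul_sum, add_mul]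
      rw [Finset.sum_add_distrib]
      exact congrArg₂ (· + ·) (Finset.sum_congr rfl fun i _ => by ring) (Finset.sum_congr rfl fun i _ => by ring)
    have e2 : ∑ i, -∫ x in (cylinderCell L : Set ℝ³), (Φ x * t i x) * ⟪G x, b i⟫ = -R := by
      rw [Finset.sum_neg_distrib, ← integral_finsetSum _ fun i _ => IcG (φ := fun x => Φ x * t i x) (hΦ.continuous.mul (htc i)) i, hR]
      congr 1
      refine integral_congr_ae (Eventually.of_forall fun x => ?_)
      simp only [hexpand θ x, Finset.mul_sum]
      exact Finset.sum_congr rfl fun i _ => by simp only [ht]; ring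
    rw [← e1, ← e2]
    exact Finset.sum_congr rfl fun i _ => S2 i
  -- (W): the weak equation with the periodic test function `θΦ`: `R + B = H0 + (R1 + B1)`
  have hW : R + B = H0 + (R1 + B1) := by
    have hψ : IsSmoothPeriodic L (fun x => θ x * Φ x) :=
      ⟨(hθ.mul hΦ).contDiffOn, fun x => by simp only [hθp x, hΦp x]⟩
    have hmean' : ∫ x in (cylinderCell L : Set ℝ³), (toCell L h₀ : ℝ³ → ℝ) x = 0 := by
      rw [← hmean]; exact integral_congr_ae (coeFn_toCell hh₀.memLp)
    have key := setIntegral_inner_neumannGrad_cylGrad hL hmean' (toCell L h₁) hψ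
    -- convert `cylGrad (θΦ)` to `fderiv` on the cell and expand the product rule
    have hprod : ∀ x ∈ (cylinderCell L : Set ℝ³), ∀ w : ℝ³, ⟪w, cylGrad (fun x => θ x * Φ x) x⟫ =
        Φ x * fderiv ℝ θ x w + θ x * fderiv ℝ Φ x w := fun x hx w => by
      rw [inner_cylGrad_right, ← cylDeriv_apply (fun _ => w) _ x,
        cylDeriv_eq_fderiv _ _ (cylinderCell_le_unitCylinder L hx), fderiv_fun_mul (hθd x) (hΦd x)]
      simp only [_root_.add_apply, _root_.FunLike.coe_smul, Pi.smul_apply, smul_eq_mul]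
      ring
    have l1 : ∫ x in (cylinderCell L : Set ℝ³), ⟪(((Gg : gradSpace L) : Lp ℝ³ 2 (cellMeasure L)) : ℝ³ → ℝ³) x,
        cylGrad (fun x => θ x * Φ x) x⟫ = R + B := by
      rw [hR, hB, ← integral_add]
      · exact setIntegral_congr_fun (cylinderCell L).isOpen.measurableSet fun x hx => hprod x hx _
      · -- `Φ ∂θ(G)` integrable: expand in the basis
        have : (fun x => Φ x * fderiv ℝ θ x (G x)) = fun x => ∑ i, (Φ x * t i x) * ⟪G x, b i⟫ := by
          funext x; rw [hexpand θ x, Finset.mul_sum]; exact Finset.sum_congr rfl fun i _ => by simp only [ht]; ring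
        rw [this]; exact integrable_finsetSum _ fun i _ => IcG (φ := fun x => Φ x * t i x) (hΦ.continuous.mul (htc i)) i
      · have : (fun x => θ x * fderiv ℝ Φ x (G x)) = fun x => ∑ i, (θ x * g i x) * ⟪G x, b i⟫ := by
          funext x; rw [hexpand Φ x, Finset.mul_sum]; exact Finset.sum_congr rfl fun i _ => by simp only [hg]; ring
        rw [this]; exact integrable_finsetSum _ fun i _ => IcG (φ := fun x => θ x * g i x) (hθ.continuous.mul (hgc i)) i
    have l2 : ∫ x in (cylinderCell L : Set ℝ³), (toCell L h₀ : ℝ³ → ℝ) x * (θ x * Φ x) = H0 := by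
      rw [hH0]; exact integral_congr_ae (by filter_upwards [coeFn_toCell hh₀.memLp] with x hx; rw [hx])
    have l3 : ∫ x in (cylinderCell L : Set ℝ³), ⟪(toCell L h₁ : ℝ³ → ℝ³) x, cylGrad (fun x => θ x * Φ x) x⟫ = R1 + B1 := by
      rw [hR1, hB1, ← integral_add]
      · refine integral_congr_ae ?_
        filter_upwards [coeFn_toCell hh₁.memLp, ae_restrict_mem (cylinderCell L).isOpen.measurableSet] with x hx hxc
        rw [hx, hprod x hxc]
      · exact integrableOn_cylinderCell_of_continuousOn_K L (hΦ.continuous.continuousOn.mul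
          (((hθ.continuous_fderiv (by simp)).continuousOn).clm_apply hh₁.continuousOn))
      · exact integrableOn_cylinderCell_of_continuousOn_K L (hθ.continuous.continuousOn.mul
          (((hΦ.continuous_fderiv (by simp)).continuousOn).clm_apply hh₁.continuousOn))
    rw [l1, l2, l3] at key
    exact key
  -- (D): Gauss–Green with `W = θ h₁`: `DV + R1 + B1 = 0`
  have hD : DV + R1 + B1 = 0 := by
    have hWc : ContDiffOn ℝ 1 (fun y => θ y • h₁ y) 𝕂 :=
      (hθ.of_le (by norm_cast)).contDiffOn.smul (hh₁.smooth.of_le (by norm_cast))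
    have hslip : ∀ x ∈ frontier (unitCylinder : Set ℝ³), ⟪θ x • h₁ x, eR x⟫ = 0 := fun x hx => by
      rw [frontier_unitCylinder] at hx
      have hx1 : cylRadius x = 1 := hx
      rw [hθ0 x (by rw [hx1]; linarith), zero_smul, inner_zero_left]
    have h := setIntegral_mul_divergence_add_fderiv_eq_zero hL (hΦ.of_le (by norm_cast)).contDiffOn hWc hslip hΦp
      (fun x => by simp only [hθp x, hh₁.periodic x])
    have K1 : Integrable (fun x => Φ x * θ x * VectorCalculus.divergence h₁ x) (cellMeasure L) :=
      (integrableOn_cylinderCell_of_continuousOn_K L ((hΦ.continuous.mul hθ.continuous).continuousOn.mul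
        (contDiffOn_cylDiv hh₁.smooth).continuousOn)).congr_fun (fun x hx => by
          simp only [Pi.mul_apply, cylDiv_eq_divergence h₁ (cylinderCell_le_unitCylinder L hx)]) (cylinderCell L).isOpen.measurableSet
    have K2 : Integrable (fun x => Φ x * fderiv ℝ θ x (h₁ x)) (cellMeasure L) :=
      integrableOn_cylinderCell_of_continuousOn_K L (hΦ.continuous.continuousOn.mul
        (((hθ.continuous_fderiv (by simp)).continuousOn).clm_apply hh₁.continuousOn))
    have K3 : Integrable (fun x => θ x * fderiv ℝ Φ x (h₁ x)) (cellMeasure L) :=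
      integrableOn_cylinderCell_of_continuousOn_K L (hθ.continuous.continuousOn.mul
        (((hΦ.continuous_fderiv (by simp)).continuousOn).clm_apply hh₁.continuousOn))
    have K12 : Integrable (fun x => Φ x * θ x * VectorCalculus.divergence h₁ x + Φ x * fderiv ℝ θ x (h₁ x))
        (cellMeasure L) := K1.add K2
    rw [hDV, hR1, hB1, ← integral_add K1 K2, ← integral_add K12 K3, ← h]
    refine setIntegral_congr_fun (cylinderCell L).isOpen.measurableSet fun x hx => ?_
    have hxU : cylRadius x < 1 := cylinderCell_le_unitCylinder L hx
    have dθ : DifferentiableAt ℝ θ x := hθd x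
    have dh : DifferentiableAt ℝ h₁ x := differentiableAt_of_contDiffOn_closure (hh₁.smooth.of_le (by norm_cast)) hxU
    rw [divergence_smul_apply dθ dh, inner_gradient_eq_fderiv, map_smul, smul_eq_mul]
    ring
  -- the right-hand side: `DV − H0 + 2R + Q`
  have hrhs : ∫ x in (cylinderCell L : Set ℝ³), (θ x * (VectorCalculus.divergence h₁ x - h₀ x) +
      2 * fderiv ℝ θ x (G x) + q x * ∑ i, fderiv ℝ (t i) x (b i)) * Φ x = DV - H0 + 2 * R + Q := by
    have J1 : Integrable (fun x => Φ x * θ x * VectorCalculus.divergence h₁ x) (cellMeasure L) :=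
      (integrableOn_cylinderCell_of_continuousOn_K L ((hΦ.continuous.mul hθ.continuous).continuousOn.mul
        (contDiffOn_cylDiv hh₁.smooth).continuousOn)).congr_fun (fun x hx => by
          simp only [Pi.mul_apply, cylDiv_eq_divergence h₁ (cylinderCell_le_unitCylinder L hx)]) (cylinderCell L).isOpen.measurableSet
    have J2 : Integrable (fun x => h₀ x * (θ x * Φ x)) (cellMeasure L) :=
      integrableOn_cylinderCell_of_continuousOn_K L (hh₀.continuousOn.mul (hθ.continuous.mul hΦ.continuous).continuousOn)
    have J3 : Integrable (fun x => Φ x * fderiv ℝ θ x (G x)) (cellMeasure L) := by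
      have : (fun x => Φ x * fderiv ℝ θ x (G x)) = fun x => ∑ i, (Φ x * t i x) * ⟪G x, b i⟫ := by
        funext x; rw [hexpand θ x, Finset.mul_sum]; exact Finset.sum_congr rfl fun i _ => by simp only [ht]; ring
      rw [this]; exact integrable_finsetSum _ fun i _ => IcG (φ := fun x => Φ x * t i x) (hΦ.continuous.mul (htc i)) i
    have J4 : Integrable (fun x => Φ x * q x * ∑ i, fderiv ℝ (t i) x (b i)) (cellMeasure L) :=
      (Icq (φ := fun x => Φ x * ∑ i, fderiv ℝ (t i) x (b i)) (hΦ.continuous.mul hΔθc)).congr (Eventually.of_forall fun x => by ring)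
    have J12 : Integrable (fun x => Φ x * θ x * VectorCalculus.divergence h₁ x - h₀ x * (θ x * Φ x)) (cellMeasure L) :=
      J1.sub J2
    have J3' : Integrable (fun x => 2 * (Φ x * fderiv ℝ θ x (G x))) (cellMeasure L) := J3.const_mul 2
    have J123 : Integrable (fun x => (Φ x * θ x * VectorCalculus.divergence h₁ x - h₀ x * (θ x * Φ x)) +
        2 * (Φ x * fderiv ℝ θ x (G x))) (cellMeasure L) := J12.add J3'
    rw [hDV, hH0, hR, hQ, ← integral_sub J1 J2, ← integral_const_mul, ← integral_add J12 J3', ← integral_add J123 J4]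
    exact integral_congr_ae (Eventually.of_forall fun x => by ring)
  rw [← hA, hrhs]
  linarith [hS1, hS2, hW, hD]

end PeriodicCylinder

end Literature.Analysis.FluidPDE
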